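import Literature.NumberTheory.Sieve.CFSemigroupCongruenceOperatorBound
import HarnessLib

/-!
# The scalar resolvents `(1 ∓ L_s)⁻¹` on a strip left of `δ_A` with bounded imaginary part

Support file (all results proved) for the reduction of the named fact
`Literature.NumberTheory.Sieve.MageeOhWinter2019_uniformCounting` to [MageeOhWinter2019, Thm. 4].
Theorem 4 of [MageeOhWinter2019] controls the congruence transfer operators on functions with values in
`ℂ^{Γ_q} ⊖ 1` (part (1), bounded `|Im s|`) and on all of `ℂ^{Γ_q}` for large `|Im s|` (part (2)); the
remaining piece — the SCALAR operator `L_s` for bounded `|Im s|` slightly to the left of `δ_A` — is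
classical (Lalley/Naud perturbation theory) and follows from results already in the tree by compactness:

* the resolvent has a simple pole at `δ_A` (`cfResolvent_pole'`), so `1 - L_s` is invertible on a
  punctured disc around `δ_A`;
* `1 - L_{δ+it}` (`t ≠ 0`) and `1 + L_s` (`Re s ≥ δ`) are invertible (`isUnit_one_sub_cfLOp`,
  `isUnit_one_add_cfLOp`), the set of `s` with `1 ∓ L_s` invertible is open (`s ↦ L_s` is continuous,
  units are open), and compact segments have uniform neighbourhoods.

Main results: `exists_strip_isUnit_cfLOp` (invertibility of `1 ∓ L_s` for `δ - ε₁ < Re s`,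
`|Im s| ≤ b₀`, `s ≠ δ`) and `exists_strip_regular_bound` (a uniform bound for the regular part
`(1 - L_s²)⁻¹ - (s-δ)⁻¹ (2κ_A)⁻¹ Π` on `δ - ε₁ ≤ Re s ≤ δ + 1`, `|Im s| ≤ b₀`).

## References

* [MageeOhWinter2019] M. Magee, H. Oh, D. Winter, J. reine angew. Math. 753 (2019) 89–135, §3.4
  (Lemma 16, Prop. 17: "the non-congruence part … in principle understood without the results of this paper").
-/

noncomputable section

open Set Filter Metric Complex
open scoped Topology

namespace Literature.NumberTheory.Sieve

variable {A : Finset ℕ} (hA : ∀ a ∈ A, 1 ≤ a) (h2 : 2 ≤ A.card)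

/-! ### Ring inverses: two general lemmas -/

section RingInverse

variable {R : Type*} [Ring R]

/-- A two-sided inverse is the ring inverse. [folklore] -/
theorem Ring.inverse_eq_of_mul_eq_one {a b : R} (hab : a * b = 1) (hba : b * a = 1) :
    IsUnit a ∧ Ring.inverse a = b := by
  let u : Rˣ := ⟨a, b, hab, hba⟩
  exact ⟨⟨u, rfl⟩, Ring.inverse_unit u⟩

variable [Algebra ℂ R]

/-- **`(1 - L²)⁻¹ = ½((1 - L)⁻¹ + (1 + L)⁻¹)`** for ring inverses, when `1 ∓ L` are units. [folklore] -/
theorem Ring.inverse_one_sub_sq {L : R} (hm : IsUnit (1 - L)) (hp : IsUnit (1 + L)) :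
    IsUnit (1 - L ^ 2) ∧
      Ring.inverse (1 - L ^ 2) = (1 / 2 : ℂ) • (Ring.inverse (1 - L) + Ring.inverse (1 + L)) := by
  obtain ⟨u, hu⟩ := hm
  obtain ⟨v, hv⟩ := hp
  have hfac : (1 : R) - L ^ 2 = (1 + L) * (1 - L) := by
    have := (Commute.one_left L).sq_sub_sq; rw [one_pow] at this; exact this
  -- the candidate inverse `u⁻¹ v⁻¹` of `v u`
  have hinv : IsUnit (1 - L ^ 2) ∧ Ring.inverse (1 - L ^ 2) = ((u⁻¹ : Rˣ) : R) * ((v⁻¹ : Rˣ) : R) := by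
    refine Ring.inverse_eq_of_mul_eq_one ?_ ?_
    · rw [hfac, ← hu, ← hv, mul_assoc, ← mul_assoc (u : R), Units.mul_inv, one_mul, Units.mul_inv]
    · rw [hfac, ← hu, ← hv, mul_assoc, ← mul_assoc ((v⁻¹ : Rˣ) : R), Units.inv_mul, one_mul, Units.inv_mul]
  refine ⟨hinv.1, ?_⟩
  rw [hinv.2, ← hu, ← hv, Ring.inverse_unit, Ring.inverse_unit]
  -- `u⁻¹ v⁻¹ = ½ (u⁻¹ + v⁻¹)` since `u + v = 2`
  have hsum : (u : R) + v = (2 : ℂ) • (1 : R) := by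
    rw [hu, hv, two_smul]; abel
  have key : ((u⁻¹ : Rˣ) : R) + ((v⁻¹ : Rˣ) : R) = (2 : ℂ) • (((u⁻¹ : Rˣ) : R) * ((v⁻¹ : Rˣ) : R)) := by
    have e1 : ((u⁻¹ : Rˣ) : R) * ((u : R) + v) * ((v⁻¹ : Rˣ) : R) = ((v⁻¹ : Rˣ) : R) + ((u⁻¹ : Rˣ) : R) := by
      rw [mul_add, add_mul, Units.inv_mul, one_mul, mul_assoc, Units.mul_inv, mul_one]
    rw [hsum, mul_smul_comm, smul_mul_assoc, mul_one] at e1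
    rw [add_comm, ← e1]
  rw [key, smul_smul]
  norm_num

end RingInverse

/-! ### Openness and the compact segments -/

section Strip

/-- The set of `s` with `1 - L_s` a unit is open. [folklore] -/
theorem isOpen_isUnit_one_sub_cfLOp : IsOpen {s : ℂ | IsUnit (1 - cfLOp A hA s)} :=
  Units.isOpen.preimage (continuous_const.sub (continuous_cfLOp A hA))

/-- The set of `s` with `1 + L_s` a unit is open. [folklore] -/
theorem isOpen_isUnit_one_add_cfLOp : IsOpen {s : ℂ | IsUnit (1 + cfLOp A hA s)} :=
  Units.isOpen.preimage (continuous_const.add (continuous_cfLOp A hA))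

/-- A vertical compact segment `{δ + it : t ∈ K}` (`K ⊆ ℝ` compact) is compact. [folklore] -/
theorem isCompact_vertical {K : Set ℝ} (hK : IsCompact K) (δ : ℝ) :
    IsCompact ((fun t : ℝ => (δ : ℂ) + t * I) '' K) :=
  hK.image (by fun_prop)

include h2 in
/-- **Invertibility of `1 ∓ L_s` on a strip left of `δ_A` with bounded imaginary part.** For every
`b₀ > 0` there is `ε₁ > 0` such that for `δ_A - ε₁ < Re s` and `|Im s| ≤ b₀`: `1 + L_s` is a unit, and
`1 - L_s` is a unit provided `s ≠ δ_A`. [cite: MageeOhWinter2019, §3.4 (Lemma 16)] -/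
theorem exists_strip_isUnit_cfLOp (b₀ : ℝ) :
    ∃ ε₁ : ℝ, 0 < ε₁ ∧ ∀ s : ℂ, cfDimension A - ε₁ < s.re → |s.im| ≤ b₀ →
      IsUnit (1 + cfLOp A hA s) ∧ (s ≠ (cfDimension A : ℂ) → IsUnit (1 - cfLOp A hA s)) := by
  set δ : ℝ := cfDimension A with hδ
  -- the pole: invertibility on a punctured disc
  obtain ⟨εp, hεp, Wreg, -, hinv⟩ := cfResolvent_pole' A hA h2
  have hdisc : ∀ s : ℂ, dist s δ < εp → s ≠ (δ : ℂ) → IsUnit (1 - cfLOp A hA s) := fun s hs hne =>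
    (Ring.inverse_eq_of_mul_eq_one (hinv s (mem_ball.2 hs) hne).1 (hinv s (mem_ball.2 hs) hne).2).1
  -- the compact segments
  set Kp : Set ℂ := (fun t : ℝ => (δ : ℂ) + t * I) '' Icc (-b₀) b₀ with hKp
  set Km : Set ℂ := (fun t : ℝ => (δ : ℂ) + t * I) '' (Icc (-b₀) b₀ ∩ {t | εp / 2 ≤ |t|}) with hKm
  have hKpc : IsCompact Kp := isCompact_vertical isCompact_Icc δ
  have hKmc : IsCompact Km := isCompact_vertical (isCompact_Icc.inter_right (isClosed_le continuous_const continuous_abs)) δ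
  have hre : ∀ t : ℝ, ((δ : ℂ) + t * I).re = δ := fun t => by simp
  have hKpU : Kp ⊆ {s : ℂ | IsUnit (1 + cfLOp A hA s)} := by
    rintro _ ⟨t, -, rfl⟩
    exact isUnit_one_add_cfLOp A hA h2 (by rw [hre])
  have hKmU : Km ⊆ {s : ℂ | IsUnit (1 - cfLOp A hA s)} := by
    rintro _ ⟨t, ⟨-, ht⟩, rfl⟩
    have ht0 : t ≠ 0 := by
      intro h
      have ht' : εp / 2 ≤ |t| := ht
      rw [h, abs_zero] at ht'
      exact absurd ht' (not_le.2 (by positivity))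
    refine isUnit_one_sub_cfLOp A hA h2 (by rw [hre]) fun h => ht0 ?_
    have := congrArg Complex.im h
    simpa using this
  obtain ⟨rp, hrp, hthp⟩ := hKpc.exists_thickening_subset_open (isOpen_isUnit_one_add_cfLOp hA) hKpU
  obtain ⟨rm, hrm, hthm⟩ := hKmc.exists_thickening_subset_open (isOpen_isUnit_one_sub_cfLOp hA) hKmU
  refine ⟨min (min rp rm) (εp / 2), by positivity, fun s hsre hsim => ?_⟩
  have hε_rp : min (min rp rm) (εp / 2) ≤ rp := (min_le_left _ _).trans (min_le_left _ _)
  have hε_rm : min (min rp rm) (εp / 2) ≤ rm := (min_le_left _ _).trans (min_le_right _ _)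
  have hε_p : min (min rp rm) (εp / 2) ≤ εp / 2 := min_le_right _ _
  -- the vertical projection `z = δ + i Im s`
  set z : ℂ := (δ : ℂ) + s.im * I with hz
  have hdist : dist s z = |s.re - δ| := by
    rw [dist_eq_norm, hz]
    have e : s - ((δ : ℂ) + s.im * I) = ((s.re - δ : ℝ) : ℂ) := by
      apply Complex.ext <;> simp
    rw [e, Complex.norm_real, Real.norm_eq_abs]
  have htmem : s.im ∈ Icc (-b₀) b₀ := abs_le.1 hsim
  by_cases hge : δ ≤ s.re
  · exact ⟨isUnit_one_add_cfLOp A hA h2 hge, fun hne => isUnit_one_sub_cfLOp A hA h2 hge hne⟩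
  · have hge : s.re < δ := not_le.1 hge
    have hlt : |s.re - δ| < min (min rp rm) (εp / 2) := by
      rw [abs_sub_comm, abs_of_pos (by linarith)]; linarith
    refine ⟨hthp (mem_thickening_iff.2 ⟨z, ⟨s.im, htmem, rfl⟩, by rw [hdist]; linarith⟩), fun hne => ?_⟩
    by_cases him : εp / 2 ≤ |s.im|
    · exact hthm (mem_thickening_iff.2 ⟨z, ⟨s.im, ⟨htmem, him⟩, rfl⟩, by rw [hdist]; linarith⟩)
    · have him : |s.im| < εp / 2 := not_le.1 him
      refine hdisc s ?_ hne
      calc dist s δ ≤ dist s z + dist z δ := dist_triangle _ _ _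
        _ < εp / 2 + εp / 2 := by
            gcongr
            · rw [hdist]; linarith
            · rw [dist_eq_norm, hz, add_sub_cancel_left, norm_mul, Complex.norm_I, mul_one, Complex.norm_real,
                Real.norm_eq_abs]
              exact him
        _ = εp := by ring

omit hA in
/-- Continuity of `s ↦ Ring.inverse (T s)` at a point where `T s` is a unit, for continuous `T`. [folklore] -/
theorem continuousAt_ring_inverse_comp {T : ℂ → (CfLip →L[ℂ] CfLip)} (hT : Continuous T) {s : ℂ} (hs : IsUnit (T s)) :
    ContinuousAt (fun s => Ring.inverse (T s)) s := by
  obtain ⟨u, hu⟩ := hs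
  have h1 : ContinuousAt Ring.inverse (T s) := by rw [← hu]; exact NormedRing.inverse_continuousAt u
  exact h1.comp hT.continuousAt

include h2 in
/-- **Uniform bound for the regular part of the scalar resolvent on a compact strip.** For every `b₀`
there are `ε₁ > 0` and `M_X` such that for `δ_A - ε₁ ≤ Re s ≤ δ_A + 1`, `|Im s| ≤ b₀`, `s ≠ δ_A`:
`1 ∓ L_s` and `1 - L_s²` are units and
`‖(1 - L_s²)⁻¹ - (s - δ_A)⁻¹ (2κ_A)⁻¹ Π‖ ≤ M_X` (`κ_A = ∫ G dν`, the residue constant of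
`cfResolvent_pole'`; near `δ_A` the difference is `½ W_reg(s) + ½ (1 + L_s)⁻¹`).
[cite: MageeOhWinter2019, §3.4 (Lemma 16, Prop. 17)] -/
theorem exists_strip_regular_bound (b₀ : ℝ) :
    ∃ ε₁ : ℝ, 0 < ε₁ ∧ ∃ MX : ℝ, 0 ≤ MX ∧ ∀ s : ℂ, cfDimension A - ε₁ ≤ s.re → s.re ≤ cfDimension A + 1 →
      |s.im| ≤ b₀ → s ≠ (cfDimension A : ℂ) →
      IsUnit (1 - cfLOp A hA s) ∧ IsUnit (1 + cfLOp A hA s) ∧ IsUnit (1 - cfLOp A hA s ^ 2) ∧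
      ‖Ring.inverse (1 - cfLOp A hA s ^ 2) -
          ((s - cfDimension A)⁻¹ * (((2 * cfInt (cfNuδ A hA h2) (cfG A hA h2) : ℝ) : ℂ))⁻¹) • cfPi A hA h2‖ ≤ MX := by
  set δ : ℝ := cfDimension A with hδ
  set κ : ℝ := cfInt (cfNuδ A hA h2) (cfG A hA h2) with hκ
  obtain ⟨ε₀, hε₀, hunits⟩ := exists_strip_isUnit_cfLOp hA h2 b₀
  obtain ⟨εp, hεp, Wreg, han, hinv⟩ := cfResolvent_pole' A hA h2
  set ε₁ : ℝ := ε₀ / 2 with hε₁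
  have hε₁0 : 0 < ε₁ := by positivity
  -- units on the closed region
  have hU : ∀ s : ℂ, δ - ε₁ ≤ s.re → |s.im| ≤ b₀ →
      IsUnit (1 + cfLOp A hA s) ∧ (s ≠ (δ : ℂ) → IsUnit (1 - cfLOp A hA s)) :=
    fun s hs him => hunits s (by linarith) him
  -- the compact region and its two pieces
  set R : Set ℂ := Icc (δ - ε₁) (δ + 1) ×ℂ Icc (-b₀) b₀ with hR
  have hRc : IsCompact R := isCompact_Icc.reProdIm isCompact_Icc
  have hmemR : ∀ s : ℂ, δ - ε₁ ≤ s.re → s.re ≤ δ + 1 → |s.im| ≤ b₀ → s ∈ R :=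
    fun s h1 h2' h3 => ⟨⟨h1, h2'⟩, abs_le.1 h3⟩
  have hRre : ∀ s ∈ R, δ - ε₁ ≤ s.re := fun s hs => hs.1.1
  have hRim : ∀ s ∈ R, |s.im| ≤ b₀ := fun s hs => abs_le.2 hs.2
  set R₁ : Set ℂ := R ∩ closedBall (δ : ℂ) (εp / 2) with hR₁
  set R₂ : Set ℂ := R ∩ (ball (δ : ℂ) (εp / 2))ᶜ with hR₂
  have hR₁c : IsCompact R₁ := hRc.inter_right isClosed_closedBall
  have hR₂c : IsCompact R₂ := hRc.inter_right isOpen_ball.isClosed_compl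
  -- `F₊(s) = (1 + L_s)⁻¹` is continuous on `R`
  have hFp : ContinuousOn (fun s => Ring.inverse (1 + cfLOp A hA s)) R := fun s hs =>
    (continuousAt_ring_inverse_comp (continuous_const.add (continuous_cfLOp A hA))
      (hU s (hRre s hs) (hRim s hs)).1).continuousWithinAt
  obtain ⟨Cp, hCp⟩ := hRc.exists_bound_of_continuousOn hFp
  -- `W_reg` is continuous on `R₁`
  have hW : ContinuousOn Wreg R₁ := fun s hs =>
    (han s (mem_ball.2 (lt_of_le_of_lt (mem_closedBall.1 hs.2) (by linarith)))).continuousAt.continuousWithinAt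
  obtain ⟨CW, hCW⟩ := hR₁c.exists_bound_of_continuousOn hW
  -- `G(s) = (1 - L_s²)⁻¹` is continuous on `R₂`
  have hne₂ : ∀ s ∈ R₂, s ≠ (δ : ℂ) := fun s hs h => by
    have : s ∈ ball (δ : ℂ) (εp / 2) := by rw [h]; exact mem_ball_self (by positivity)
    exact hs.2 this
  have hsq : ∀ s ∈ R, s ≠ (δ : ℂ) → IsUnit (1 - cfLOp A hA s ^ 2) ∧
      Ring.inverse (1 - cfLOp A hA s ^ 2) = (1 / 2 : ℂ) • (Ring.inverse (1 - cfLOp A hA s) + Ring.inverse (1 + cfLOp A hA s)) :=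
    fun s hs hne => Ring.inverse_one_sub_sq ((hU s (hRre s hs) (hRim s hs)).2 hne) (hU s (hRre s hs) (hRim s hs)).1
  have hG : ContinuousOn (fun s => Ring.inverse (1 - cfLOp A hA s ^ 2)) R₂ := fun s hs =>
    (continuousAt_ring_inverse_comp (continuous_const.sub ((continuous_cfLOp A hA).pow 2))
      (hsq s hs.1 (hne₂ s hs)).1).continuousWithinAt
  obtain ⟨CG, hCG⟩ := hR₂c.exists_bound_of_continuousOn hG
  -- the bound
  set MX : ℝ := max (max (1 / 2 * CW + 1 / 2 * Cp) (CG + (εp / 2)⁻¹ * ‖(((2 * κ : ℝ) : ℂ))⁻¹‖ * ‖cfPi A hA h2‖)) 0 with hMX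
  refine ⟨ε₁, hε₁0, MX, le_max_right _ _, fun s hsre hsre' hsim hne => ?_⟩
  have hsR : s ∈ R := hmemR s hsre hsre' hsim
  obtain ⟨hp, hm⟩ := hU s hsre hsim
  have hm' := hm hne
  obtain ⟨hsqU, hsqE⟩ := hsq s hsR hne
  refine ⟨hm', hp, hsqU, ?_⟩
  by_cases hnear : s ∈ closedBall (δ : ℂ) (εp / 2)
  · -- near the pole: `(1 - L²)⁻¹ - c Π = ½ W_reg + ½ (1 + L)⁻¹`
    have hball : s ∈ ball (δ : ℂ) εp := mem_ball.2 (lt_of_le_of_lt (mem_closedBall.1 hnear) (by linarith))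
    obtain ⟨h1, h2'⟩ := hinv s hball hne
    obtain ⟨-, hRinv⟩ := Ring.inverse_eq_of_mul_eq_one h1 h2'
    have e : Ring.inverse (1 - cfLOp A hA s ^ 2) - ((s - δ)⁻¹ * (((2 * κ : ℝ) : ℂ))⁻¹) • cfPi A hA h2 =
        (1 / 2 : ℂ) • Wreg s + (1 / 2 : ℂ) • Ring.inverse (1 + cfLOp A hA s) := by
      rw [hsqE, hRinv, smul_add, smul_add]
      have hc : (1 / 2 : ℂ) • (((s - δ)⁻¹ * ((κ : ℝ) : ℂ)⁻¹) • cfPi A hA h2) =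
          ((s - δ)⁻¹ * (((2 * κ : ℝ) : ℂ))⁻¹) • cfPi A hA h2 := by
        rw [smul_smul]; congr 1; push_cast; ring
      rw [hc]; abel
    rw [e]
    calc ‖(1 / 2 : ℂ) • Wreg s + (1 / 2 : ℂ) • Ring.inverse (1 + cfLOp A hA s)‖
        ≤ ‖(1 / 2 : ℂ) • Wreg s‖ + ‖(1 / 2 : ℂ) • Ring.inverse (1 + cfLOp A hA s)‖ := norm_add_le _ _
      _ ≤ 1 / 2 * CW + 1 / 2 * Cp := by
          rw [norm_smul, norm_smul]
          have h12 : ‖(1 / 2 : ℂ)‖ = 1 / 2 := by norm_num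
          rw [h12]
          exact add_le_add (mul_le_mul_of_nonneg_left (hCW s ⟨hsR, hnear⟩) (by norm_num))
            (mul_le_mul_of_nonneg_left (hCp s hsR) (by norm_num))
      _ ≤ MX := (le_max_left _ _).trans (le_max_left _ _)
  · -- away from the pole
    have hsR₂ : s ∈ R₂ := ⟨hsR, fun h => hnear (ball_subset_closedBall h)⟩
    have hdist : εp / 2 ≤ ‖s - δ‖ := by
      have : ¬ dist s δ < εp / 2 := fun h => hnear (mem_closedBall.2 h.le)
      rw [dist_eq_norm] at this; exact not_lt.1 this
    have hinvle : ‖(s - (δ : ℂ))⁻¹‖ ≤ (εp / 2)⁻¹ := by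
      rw [norm_inv]; exact inv_anti₀ (by positivity) hdist
    calc ‖Ring.inverse (1 - cfLOp A hA s ^ 2) - ((s - δ)⁻¹ * (((2 * κ : ℝ) : ℂ))⁻¹) • cfPi A hA h2‖
        ≤ ‖Ring.inverse (1 - cfLOp A hA s ^ 2)‖ + ‖((s - δ)⁻¹ * (((2 * κ : ℝ) : ℂ))⁻¹) • cfPi A hA h2‖ := norm_sub_le _ _
      _ ≤ CG + (εp / 2)⁻¹ * ‖(((2 * κ : ℝ) : ℂ))⁻¹‖ * ‖cfPi A hA h2‖ := by
          refine add_le_add (hCG s hsR₂) ?_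
          rw [norm_smul, norm_mul]
          gcongr
      _ ≤ MX := (le_max_right _ _).trans (le_max_left _ _)

end Strip

end Literature.NumberTheory.Sieve
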